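import Summits.Ventures.Crystal3D.Theorems.StickyWulffConstantTextureBuildHealLabelled
import HarnessLib

/-!
# TB-1 brick L-HEAL, exchange form: the EXACT deficiency change of a surgery `X ↦ (X ∖ R) ∪ V`, and TRUNCATED healing (no clean collar needed)
# (lane T, crux `TextureLiminfV5`, stmt-Ventures-23912; blueprint HOME/wulff-p2/g23/TB-COVER-BLUEPRINT-g23.md step S3, memo HOME/wulff-p2/g24/HEAL-g24.md)

HONEST FRAMING. Venture `Summits/Ventures/Crystal3D` (cell `crystal3d-full`), route `route-Ventures-StickyWulffConstant`, helper `--supports` the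
law-v5 crux `TextureLiminfV5` (stmt-Ventures-23912).  Pure finite combinatorics over '…TextureBuildFill' / '…Heal' / '…HealLabelled' (census-free, standard
axioms).  Nothing about any cover or texture is claimed; F-C1 not moved.

WHY.  `contactDeficiency_heal_le` ('…Heal') and `exists_healed_clusters` ('…HealClusters') heal defect clusters with a CLEAN SOLID COLLAR — the clusters that
do not chain to a wall ('…DefectSelection').  Defects ATTACHED to a wall (a crack or a chain of bounded junk running from the wall into the grain: «tentacles»,
the line features that spoil plate completeness at every lateral scale at bounded cost, memo HEAL-g24.md §2) have no clean collar at their wall end, but cutting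
them two sites away from the wall still LOWERS the deficiency: refilling a lattice site with `k` kept occupied neighbours and `j` refilled neighbours changes
`D = 6#X − b` by `6 − k − j/2`, which is `≤ 0` as soon as `2k + j ≥ 12`, e.g. when the site keeps at least as many occupied lattice neighbours as it has
abandoned vacant ones.  This file is that bookkeeping, exactly:

* **`contactDeficiency_exchange_eq`** — for `R ⊆ X` and `V` disjoint from `X ∖ R`:
  `D((X ∖ R) ∪ V) = D(X) + Σ_{a ∈ R} (cdeg_X a − ½·cdeg_R a − 6) + Σ_{v ∈ V} (6 − cdeg_{X∖R} v − ½·cdeg_V v)` (twice '…Fill's `contactDeficiency_superset_eq`);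
* `contactDeficiency_sdiff_eq` / **`contactDeficiency_sdiff_le_of_degree_le_six`** — removing balls of degree `≤ 6` never raises `D` (free junk is free);
* `contactDeficiency_exchange_le` — local criterion: removed balls of degree `≤ 6`, refilled points with `2·cdeg_{X∖R} v + cdeg_V v ≥ 12` ⇒ `D ≤`;
  `contactDeficiency_exchange_le_of_sum` — the aggregate criterion (compensation allowed);
* `twelve_le_two_mul_cdeg_add_cdeg` — LATTICE CRITERION: a site of a moved Barlow stacking whose touching sites outside `K ∪ V` are at most as many as its
  touching balls of `K` on the stacking satisfies `2·cdeg_K v + cdeg_V v ≥ 12`;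
* **`exists_truncated_heal`** — TRUNCATED HEAL, labelled: `x` a unit packing, `S` a moved Barlow stacking, `R` a set of balls of degree `≤ 6`, `V` a finite set
  of vacant `S`-sites admissible against the kept balls, each with (abandoned vacant touching sites) `≤` (kept touching balls on `S`) ⇒ a unit packing `x'`
  enumerating `(range x ∖ R) ∪ V` with `6N' − b(x') ≤ 6N − b(x)` and `N ≤ N' + #R`.
-/

noncomputable section

namespace Summit.Ventures.Crystal3D.Theorems

open Finset Summit.Ventures.Crystal3D
open Literature.MathematicalPhysics.StatisticalMechanics (IsHaggSeq contactDeficiency)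
open Summit.Ventures.Crystal3D.Cruxes.TextureLiminf.TexShadow (E3 stacking one_le_dist_of_mem_stacking)

/-! ## The exchange identity -/

section Exchange

variable {X R V : Finset E3}

/-- **EXCHANGE IDENTITY**: the exact change of `D = 6# − b` under `X ↦ (X ∖ R) ∪ V` (`R ⊆ X`, `V` disjoint from the kept balls). -/
theorem contactDeficiency_exchange_eq (hR : R ⊆ X) (hV : Disjoint V (X \ R)) :
    contactDeficiency ((X \ R) ∪ V) = contactDeficiency X +
      ∑ a ∈ R, ((cdeg X a : ℝ) - (cdeg R a : ℝ) / 2 - 6) +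
      ∑ v ∈ V, ((6 : ℝ) - (cdeg (X \ R) v : ℝ) - (cdeg V v : ℝ) / 2) := by
  classical
  set K : Finset E3 := X \ R with hK
  have hKX : K ⊆ X := Finset.sdiff_subset
  have hXK : X \ K = R := by rw [hK, Finset.sdiff_sdiff_eq_self hR]
  have hKX' : K ⊆ K ∪ V := Finset.subset_union_left
  have hX'K : (K ∪ V) \ K = V := by rw [Finset.union_sdiff_left, Finset.sdiff_eq_self_of_disjoint hV]
  have h1 := contactDeficiency_superset_eq hKX
  have h2 := contactDeficiency_superset_eq hKX'
  rw [hXK] at h1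
  rw [hX'K] at h2
  have hsplit : ∀ a, (cdeg X a : ℝ) = (cdeg K a : ℝ) + (cdeg R a : ℝ) := fun a => by
    have := cdeg_eq_add_sdiff hKX a
    rw [hXK] at this
    exact_mod_cast this
  have hneg : ∑ a ∈ R, ((cdeg X a : ℝ) - (cdeg R a : ℝ) / 2 - 6) =
      -∑ a ∈ R, ((6 : ℝ) - (cdeg K a : ℝ) - (cdeg R a : ℝ) / 2) := by
    rw [← Finset.sum_neg_distrib]
    refine Finset.sum_congr rfl fun a _ => ?_
    rw [hsplit a]; ring
  rw [hneg, h2]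
  linarith

/-- **Removal identity**: `D(X ∖ R) = D(X) + Σ_{a ∈ R} (cdeg_X a − ½·cdeg_R a − 6)`. -/
theorem contactDeficiency_sdiff_eq (hR : R ⊆ X) :
    contactDeficiency (X \ R) = contactDeficiency X + ∑ a ∈ R, ((cdeg X a : ℝ) - (cdeg R a : ℝ) / 2 - 6) := by
  classical
  have h := contactDeficiency_exchange_eq (V := ∅) hR (Finset.disjoint_empty_left _)
  rw [Finset.union_empty, Finset.sum_empty, add_zero] at h
  exact h

/-- **Free junk is free**: removing balls of degree `≤ 6` never raises the deficiency. -/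
theorem contactDeficiency_sdiff_le_of_degree_le_six (hR : R ⊆ X) (hdeg : ∀ a ∈ R, cdeg X a ≤ 6) :
    contactDeficiency (X \ R) ≤ contactDeficiency X := by
  rw [contactDeficiency_sdiff_eq hR]
  have : ∑ a ∈ R, ((cdeg X a : ℝ) - (cdeg R a : ℝ) / 2 - 6) ≤ 0 := by
    refine Finset.sum_nonpos fun a ha => ?_
    have h6 : (cdeg X a : ℝ) ≤ 6 := by exact_mod_cast hdeg a ha
    have h0 : (0 : ℝ) ≤ (cdeg R a : ℝ) := Nat.cast_nonneg _
    linarith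
  linarith

/-- **Aggregate criterion**: if the removal terms and the refill terms sum to `≤ 0`, the surgery does not raise `D`. -/
theorem contactDeficiency_exchange_le_of_sum (hR : R ⊆ X) (hV : Disjoint V (X \ R))
    (h : ∑ a ∈ R, ((cdeg X a : ℝ) - (cdeg R a : ℝ) / 2 - 6) + ∑ v ∈ V, ((6 : ℝ) - (cdeg (X \ R) v : ℝ) - (cdeg V v : ℝ) / 2) ≤ 0) :
    contactDeficiency ((X \ R) ∪ V) ≤ contactDeficiency X := by
  rw [contactDeficiency_exchange_eq hR hV]
  linarith

/-- **Local criterion**: removed balls of degree `≤ 6`, and every refilled point `v` with `2·cdeg_{X∖R} v + cdeg_V v ≥ 12`, give `D((X ∖ R) ∪ V) ≤ D(X)`. -/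
theorem contactDeficiency_exchange_le (hR : R ⊆ X) (hV : Disjoint V (X \ R)) (hdeg : ∀ a ∈ R, cdeg X a ≤ 6)
    (hfill : ∀ v ∈ V, 12 ≤ 2 * cdeg (X \ R) v + cdeg V v) :
    contactDeficiency ((X \ R) ∪ V) ≤ contactDeficiency X := by
  refine contactDeficiency_exchange_le_of_sum hR hV ?_
  have h1 : ∑ a ∈ R, ((cdeg X a : ℝ) - (cdeg R a : ℝ) / 2 - 6) ≤ 0 := by
    refine Finset.sum_nonpos fun a ha => ?_
    have h6 : (cdeg X a : ℝ) ≤ 6 := by exact_mod_cast hdeg a ha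
    have h0 : (0 : ℝ) ≤ (cdeg R a : ℝ) := Nat.cast_nonneg _
    linarith
  have h2 : ∑ v ∈ V, ((6 : ℝ) - (cdeg (X \ R) v : ℝ) - (cdeg V v : ℝ) / 2) ≤ 0 := by
    refine Finset.sum_nonpos fun v hv => ?_
    have h12 : (12 : ℝ) ≤ 2 * (cdeg (X \ R) v : ℝ) + (cdeg V v : ℝ) := by exact_mod_cast hfill v hv
    linarith
  linarith

end Exchange

/-! ## The lattice criterion for a refilled site -/

section Lattice

variable {L : E3 ≃ₗᵢ[ℝ] E3} {s : E3} {σ : ℤ → ℤ}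

open scoped Classical in
/-- **LATTICE CRITERION**: a site `v` of a moved Barlow stacking `S` whose touching `S`-sites outside `K ∪ V` (the ABANDONED ones) are at most as many as
its touching balls of `K` on `S` (the KEPT ones) has `2·cdeg_K v + cdeg_V v ≥ 12`. -/
theorem twelve_le_two_mul_cdeg_add_cdeg (hσ : IsHaggSeq σ) {v : E3} (hv : v ∈ stacking L s σ) (K V : Finset E3)
    (h : {w | w ∈ stacking L s σ ∧ dist v w = 1 ∧ w ∉ K ∧ w ∉ V}.ncard ≤
      (K.filter fun q => q ∈ stacking L s σ ∧ dist v q = 1).card) :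
    12 ≤ 2 * cdeg K v + cdeg V v := by
  classical
  have hT12 : {w | w ∈ stacking L s σ ∧ dist v w = 1}.ncard = 12 := ncard_touching_stacking_eq_twelve hσ hv
  have hTfin : {w | w ∈ stacking L s σ ∧ dist v w = 1}.Finite := Set.finite_of_ncard_pos (by rw [hT12]; norm_num)
  -- the twelve touching sites split into kept balls, refilled points and abandoned sites
  have hsub : {w | w ∈ stacking L s σ ∧ dist v w = 1} ⊆
      ((↑(K.filter fun q => dist v q = 1) ∪ ↑(V.filter fun q => dist v q = 1)) ∪
        {w | w ∈ stacking L s σ ∧ dist v w = 1 ∧ w ∉ K ∧ w ∉ V} : Set E3) := by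
    rintro w ⟨hwS, hwd⟩
    by_cases hwK : w ∈ K
    · exact Set.mem_union_left _ (Set.mem_union_left _ (Finset.mem_coe.2 (Finset.mem_filter.2 ⟨hwK, hwd⟩)))
    · by_cases hwV : w ∈ V
      · exact Set.mem_union_left _ (Set.mem_union_right _ (Finset.mem_coe.2 (Finset.mem_filter.2 ⟨hwV, hwd⟩)))
      · exact Set.mem_union_right _ ⟨hwS, hwd, hwK, hwV⟩
  have hfinU : ((↑(K.filter fun q => dist v q = 1) ∪ ↑(V.filter fun q => dist v q = 1)) ∪
      {w | w ∈ stacking L s σ ∧ dist v w = 1 ∧ w ∉ K ∧ w ∉ V} : Set E3).Finite :=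
    ((Finset.finite_toSet _).union (Finset.finite_toSet _)).union (hTfin.subset fun w hw => ⟨hw.1, hw.2.1⟩)
  have h1 := Set.ncard_le_ncard hsub hfinU
  have h2 := Set.ncard_union_le (↑(K.filter fun q => dist v q = 1) ∪ ↑(V.filter fun q => dist v q = 1) : Set E3)
    {w | w ∈ stacking L s σ ∧ dist v w = 1 ∧ w ∉ K ∧ w ∉ V}
  have h3 := Set.ncard_union_le (↑(K.filter fun q => dist v q = 1) : Set E3) (↑(V.filter fun q => dist v q = 1) : Set E3)
  rw [Set.ncard_coe_finset, Set.ncard_coe_finset] at h3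
  rw [hT12] at h1
  -- the abandoned sites are outnumbered by the kept lattice balls, themselves among the kept touching balls
  have h4 : (K.filter fun q => q ∈ stacking L s σ ∧ dist v q = 1).card ≤ (K.filter fun q => dist v q = 1).card :=
    Finset.card_le_card fun q hq => by
      rw [Finset.mem_filter] at hq ⊢
      exact ⟨hq.1, hq.2.2⟩
  unfold cdeg
  omega

end Lattice

/-! ## Truncated healing, labelled -/

section Truncated

variable {N : ℕ} {x : Fin N → E3} {L : E3 ≃ₗᵢ[ℝ] E3} {s : E3} {σ : ℤ → ℤ}

open scoped Classical in
/-- **TRUNCATED HEAL**: remove a set `R` of balls of degree `≤ 6` and refill a finite set `V` of vacant sites of a moved Barlow stacking `S`, admissible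
against the kept balls, each refilled site having at most as many abandoned vacant touching sites (outside the kept balls and `V`) as kept touching balls on
`S`.  The result is a unit packing with no larger deficiency and at least `N − #R` balls.  No collar hypothesis: this is the form that heals a crack or a chain
of weakly bound junk CUT two sites away from a wall. -/
theorem exists_truncated_heal (hx : IsUnitPacking x) (hσ : IsHaggSeq σ) (R V : Finset E3)
    (hR : ↑R ⊆ Set.range x) (hdeg : ∀ a ∈ R, cdeg (Finset.univ.image x) a ≤ 6)
    (hVS : ∀ v ∈ V, v ∈ stacking L s σ) (hVvac : ∀ v ∈ V, v ∉ Set.range x)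
    (hVadm : ∀ v ∈ V, ∀ i, x i ∉ R → 1 ≤ dist (x i) v)
    (hfill : ∀ v ∈ V, {w | w ∈ stacking L s σ ∧ dist v w = 1 ∧ w ∉ Finset.univ.image x \ R ∧ w ∉ V}.ncard ≤
      ((Finset.univ.image x \ R).filter fun q => q ∈ stacking L s σ ∧ dist v q = 1).card) :
    ∃ (N' : ℕ) (x' : Fin N' → E3), IsUnitPacking x' ∧
      Finset.univ.image x' = (Finset.univ.image x \ R) ∪ V ∧
      6 * (N' : ℝ) - (numContacts x' : ℝ) ≤ 6 * (N : ℝ) - (numContacts x : ℝ) ∧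
      N ≤ N' + R.card := by
  classical
  set X : Finset E3 := Finset.univ.image x with hXdef
  have hXsep := image_sep hx
  have hmemX : ∀ {a : E3}, a ∈ X ↔ a ∈ Set.range x := fun {a} => by
    rw [hXdef]; exact mem_image_univ_iff_mem_range
  have hRX : R ⊆ X := fun a ha => hmemX.2 (hR (Finset.mem_coe.2 ha))
  have hVX : Disjoint V (X \ R) := by
    rw [Finset.disjoint_left]
    intro v hv hvK
    exact hVvac v hv (hmemX.1 (Finset.mem_sdiff.1 hvK).1)
  -- the new point set is `1`-separated
  have hsep : ∀ p ∈ (X \ R) ∪ V, ∀ q ∈ (X \ R) ∪ V, p ≠ q → 1 ≤ dist p q := by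
    have hmixed : ∀ a ∈ X \ R, ∀ v ∈ V, 1 ≤ dist a v := by
      intro a ha v hv
      obtain ⟨haX, haR⟩ := Finset.mem_sdiff.1 ha
      obtain ⟨i, rfl⟩ := hmemX.1 haX
      exact hVadm v hv i haR
    intro p hp q hq hpq
    rcases Finset.mem_union.1 hp with hpK | hpV <;> rcases Finset.mem_union.1 hq with hqK | hqV
    · exact hXsep p (Finset.mem_sdiff.1 hpK).1 q (Finset.mem_sdiff.1 hqK).1 hpq
    · exact hmixed p hpK q hqV
    · rw [dist_comm]; exact hmixed q hqK p hpV
    · exact one_le_dist_of_mem_stacking hσ (hVS p hpV) (hVS q hqV) hpq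
  obtain ⟨x', hx', himg⟩ := exists_enum_of_separated ((X \ R) ∪ V) hsep
  refine ⟨((X \ R) ∪ V).card, x', hx', himg, ?_, ?_⟩
  · -- deficiency: local criterion, the refill condition by the lattice criterion
    rw [← contactDeficiency_image_eq x hx.injective, ← contactDeficiency_image_eq x' hx'.injective, himg]
    refine contactDeficiency_exchange_le hRX hVX hdeg fun v hv => ?_
    exact twelve_le_two_mul_cdeg_add_cdeg hσ (hVS v hv) (X \ R) V (hfill v hv)
  · -- count
    have hN : N = X.card := (card_image_univ_eq x hx.injective).symm
    have h1 : (X \ R).card + R.card = X.card := Finset.card_sdiff_add_card_eq_card hRX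
    have h2 : (X \ R).card ≤ ((X \ R) ∪ V).card := Finset.card_le_card Finset.subset_union_left
    omega

end Truncated

end Summit.Ventures.Crystal3D.Theorems

end
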